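import Literature.Probability.LatticeModels.DisagreementPercolationProofs
import Mathlib.Order.KonigLemma
import Mathlib.MeasureTheory.Constructions.Cylinders
import Mathlib.Probability.Kernel.Composition.Prod
import HarnessLib

/-!
# Disagreement percolation: van den Berg's uniqueness theorem [vdB93, Thm 1], PROVED

Second companion («Proofs») file of `DisagreementPercolation.lean`.  It DISCHARGES the named fact
`Vandenberg1993_uniqueness` ([vdB93] = J. van den Berg, *A uniqueness condition for Gibbs measures, with
application to the 2-dimensional Ising antiferromagnet*, CMP 152 (1993) 161–166, Theorem 1 p.162: for a
Markov specification with finite or countable spin space on a countable locally finite graph, if two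
INDEPENDENT realisations of two Gibbs measures `μ, μ′` a.s. have no infinite path of disagreement, then
`μ = μ′`) as the theorem `Vandenberg1993_uniqueness_holds`.  No new definition of mathematical content and
no new fact (net debt −1); `ball`, `PathSp`, `proj`, `IsDisChain` are proof bookkeeping.

## The proof ([vdB93] p.163, followed step by step)

1. **Finite volume, two boundary conditions, countable spins** (`coupling_bound_countable`): for `Δ ⊆ Λ`
   finite and a `Δ`-local event `A`, `|γ_Λ(A|η) − γ_Λ(A|η′)| ≤ (γ_Λ^η ⊗ γ_Λ^{η′})(Δ ↔≠ ∂Λ)` — [vdB93]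
   (3)–(4).  This is [GHM01] Prop. 7.10, proved for FINITE `S` in `DisagreementPercolationProofs.lean`
   by the exchange map on the disagreement cluster of `Δ` (`DisagreementCovariance.exch₂`, weight
   invariance `weight_exch₂` = consistency + Markov property); here the same exchange argument is run on
   the COUNTABLE fibre decomposition `S^Λ` with `ℝ≥0∞`-valued sums (the good parts of the two fibre series
   agree termwise after reindexing by the exchange, `Equiv.tsum_eq`; the bad part is the mass of the fibre
   rectangles over the bad pairs, which properness places inside `{Δ ↔≠ ∂Λ}` up to a null set).
2. **DLR for the duplicated system** (`lintegral_prod_prod_eq`): `∫∫ (γ_Λ^ω ⊗ γ_Λ^η)(E) dμ dμ′ = (μ ⊗ μ′)(E)`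
   (rectangles by the DLR equations and Tonelli, then `Measure.prod_eq`), whence, integrating step 1
   against `μ ⊗ μ′` (DLR: `μ(A) = ∫ γ_Λ(A|ω) μ(dω)`),
   `|μ(A) − μ′(A)| ≤ (μ ⊗ μ′)(Δ ↔≠ ∂Λ)` for every finite `Λ ⊇ Δ` (`abs_sub_le_prod_exit`).
3. **Kőnig** (`hasInfiniteDisagreementPath_of_forall_exit`): along the balls `Λ_n = B_n(Δ)` the events
   `{Δ ↔≠ ∂Λ_n}` decrease, and a pair lying in all of them has arbitrarily long self-avoiding paths of
   disagreement from the finite set `Δ`, hence (local finiteness, Kőnig's lemma in Mathlib's form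
   `exists_seq_forall_proj_of_forall_finite`) an infinite one.  So `(μ ⊗ μ′)(Δ ↔≠ ∂Λ_n) ↓ (μ ⊗ μ′)(⋂ₙ) ≤
   (μ ⊗ μ′)(∃ infinite path of disagreement) = 0`.
4. Hence `μ(A) = μ′(A)` for all local events, and local (cylinder) events determine the measure
   (`measure_eq_of_forall_local`, π-λ).
Measurability of `{Δ ↔≠ ∂Λ}` on a countable graph is `measurableSet_disagreementExit` (chains of
disagreement, a countable union).

References: [vdB93] [cite: Vandenberg1993]; [GHM01] H.-O. Georgii, O. Häggström, C. Maes, *The random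
geometry of equilibrium phases*, §7.1 (Thm 7.1, Prop 7.10) [cite: GeorgiiHaggstromMaes2001].  Typed by cell
`ym-ir`, seat lit-3.  Nothing here concerns gauge theories or the Clay problem.
-/

open MeasureTheory Finset ProbabilityTheory
open scoped ENNReal

noncomputable section

namespace Literature.Probability.LatticeModels

namespace DisagreementUniqueness

open DisagreementCovariance

universe u v

variable {V : Type u} {S : Type v} [MeasurableSpace S]

/-! ### [vdB93] (3)–(4): the two-boundary-condition bound for a COUNTABLE spin space -/

section Countable

variable {Λ : Finset V}

omit [MeasurableSpace S] in
/-- Membership in a fibre of the restriction to `Λ`. [folklore] -/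
private theorem mem_fiber' {θ : V → S} {ζ : ↥Λ → S} {σ : V → S} :
    σ ∈ fiber Λ θ ζ ↔ ∀ x (hx : x ∈ Λ), σ x = ζ ⟨x, hx⟩ := by
  simp only [fiber, agreeOn, Set.mem_setOf_eq]
  refine forall_congr' fun x => forall_congr' fun hx => ?_
  rw [glueWith_apply_mem Λ ζ θ hx]

omit [MeasurableSpace S] in
/-- Every configuration lies in the fibre of its restriction. [folklore] -/
private theorem mem_fiber_restrict' (θ : V → S) (σ : V → S) : σ ∈ fiber Λ θ (fun x : ↥Λ => σ x) :=
  mem_fiber'.2 fun _ _ => rfl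

omit [MeasurableSpace S] in
/-- Distinct fibres are disjoint. [folklore] -/
private theorem eq_of_mem_fiber' {θ : V → S} {ζ ζ' : ↥Λ → S} {σ : V → S} (h : σ ∈ fiber Λ θ ζ)
    (h' : σ ∈ fiber Λ θ ζ') : ζ = ζ' :=
  funext fun x => ((mem_fiber'.1 h) x x.2).symm.trans ((mem_fiber'.1 h') x x.2)

omit [MeasurableSpace S] in
/-- Distinct fibres are disjoint. [folklore] -/
private theorem disjoint_fiber' (θ : V → S) {ζ ζ' : ↥Λ → S} (hne : ζ ≠ ζ') :
    Disjoint (fiber Λ θ ζ) (fiber Λ θ ζ') :=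
  Set.disjoint_left.2 fun _ h h' => hne (eq_of_mem_fiber' h h')

/-- Fibres are measurable. [folklore] -/
private theorem measurableSet_fiber' [MeasurableSingletonClass S] (θ : V → S) (ζ : ↥Λ → S) :
    MeasurableSet (fiber Λ θ ζ) := by
  have : fiber Λ θ ζ = ⋂ x ∈ Λ, (fun σ : V → S => σ x) ⁻¹' {glueWith Λ ζ θ x} := by
    ext σ; simp [fiber, agreeOn]
  rw [this]
  exact MeasurableSet.biInter Λ.countable_toSet fun x _ =>
    measurable_pi_apply x (measurableSet_singleton _)

omit [MeasurableSpace S] in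
open Classical in
/-- A `Λ`-local event meets each fibre fully or not at all. [folklore] -/
private theorem inter_fiber_eq {θ η : V → S} {A : Set (V → S)} (hdA : DependsOn (· ∈ A) (↑Λ : Set V))
    (ζ : ↥Λ → S) :
    A ∩ fiber Λ θ ζ = if glueWith Λ ζ η ∈ A then fiber Λ θ ζ else ∅ := by
  have key : ∀ σ ∈ fiber Λ θ ζ, (σ ∈ A ↔ glueWith Λ ζ η ∈ A) := fun σ hσ => by
    have h : (σ ∈ A) = (glueWith Λ ζ η ∈ A) := hdA fun x hx => by
      rw [(mem_fiber'.1 hσ) x (Finset.mem_coe.1 hx), glueWith_apply_mem Λ ζ η (Finset.mem_coe.1 hx)]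
    exact Iff.of_eq h
  split_ifs with hA
  · exact Set.inter_eq_right.2 fun σ hσ => (key σ hσ).2 hA
  · exact Set.eq_empty_of_forall_notMem fun σ hσ => hA ((key σ hσ.2).1 hσ.1)

/-- A probability measure of a `Λ`-local event as a countable sum over the fibres meeting it. [folklore] -/
private theorem measure_eq_tsum_fiber [MeasurableSingletonClass S] [Countable S] {θ η : V → S}
    (μ : Measure (V → S)) {A : Set (V → S)} (hA : MeasurableSet A)
    (hdA : DependsOn (· ∈ A) (↑Λ : Set V)) :
    μ A = ∑' ζ : ↥Λ → S, {ζ | glueWith Λ ζ η ∈ A}.indicator (fun ζ => μ (fiber Λ θ ζ)) ζ := by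
  classical
  have hcover : A = ⋃ ζ : ↥Λ → S, A ∩ fiber Λ θ ζ := by
    ext σ
    simp only [Set.mem_iUnion, Set.mem_inter_iff]
    exact ⟨fun h => ⟨_, h, mem_fiber_restrict' θ σ⟩, fun ⟨_, h, _⟩ => h⟩
  conv_lhs => rw [hcover]
  rw [measure_iUnion]
  · refine tsum_congr fun ζ => ?_
    rw [inter_fiber_eq (η := η) hdA ζ, Set.indicator_apply]
    simp only [Set.mem_setOf_eq]
    split_ifs <;> simp
  · intro ζ ζ' hne
    exact Set.disjoint_of_subset_left Set.inter_subset_right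
      (Set.disjoint_of_subset_right Set.inter_subset_right (disjoint_fiber' θ hne))
  · exact fun ζ => hA.inter (measurableSet_fiber' θ ζ)

/-- The fibre weights of a probability measure sum to one. [folklore] -/
private theorem tsum_fiber_eq_one [MeasurableSingletonClass S] [Countable S] (θ : V → S)
    (μ : Measure (V → S)) [IsProbabilityMeasure μ] : ∑' ζ : ↥Λ → S, μ (fiber Λ θ ζ) = 1 := by
  rw [← measure_iUnion (fun ζ ζ' hne => disjoint_fiber' θ hne) (measurableSet_fiber' θ),
    Set.eq_univ_of_forall fun σ => Set.mem_iUnion.2 ⟨_, mem_fiber_restrict' θ σ⟩, measure_univ]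

omit [MeasurableSpace S] in
/-- Inside `Λ` disagreement of the pair is disagreement of the `Λ`-configurations. [folklore] -/
private theorem dis₂_iff_of_mem' {η η' : V → S} {p : (↥Λ → S) × (↥Λ → S)} {v : V} (hv : v ∈ Λ) :
    Dis₂ Λ η η' p v ↔ p.1 ⟨v, hv⟩ ≠ p.2 ⟨v, hv⟩ := by
  unfold Dis₂; rw [glueWith_apply_mem Λ p.1 η hv, glueWith_apply_mem Λ p.2 η' hv]

omit [MeasurableSpace S] in
/-- Off `Λ` disagreement of the pair is disagreement of the boundary conditions. [folklore] -/
private theorem dis₂_iff_of_not_mem' {η η' : V → S} {p : (↥Λ → S) × (↥Λ → S)} {v : V} (hv : v ∉ Λ) :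
    Dis₂ Λ η η' p v ↔ η v ≠ η' v := by
  unfold Dis₂; rw [glueWith_apply_not_mem Λ p.1 η hv, glueWith_apply_not_mem Λ p.2 η' hv]

variable {G : SimpleGraph V} {Δ : Finset V} {η η' : V → S}

/-- The rectangles over the bad pairs carry `γ_Λ^η ⊗ γ_Λ^{η′}`-mass at most `(γ_Λ^η ⊗ γ_Λ^{η′})(Δ ↔≠ ∂Λ)`
(properness on the finitely many exit vertices of a witness path, for each of the countably many bad
pairs). [cite: Vandenberg1993, Theorem 1 (proof)] -/
private theorem tsum_bad_le_prod_exit [MeasurableSingletonClass S] [Countable S]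
    {γ : Specification V S} (hγ : IsSpecification γ) :
    ∑' p : (↥Λ → S) × (↥Λ → S), {p | Bad₂ G Λ Δ η η' p}.indicator
        (fun p => γ Λ η (fiber Λ η p.1) * γ Λ η' (fiber Λ η' p.2)) p ≤
      ((γ Λ η).prod (γ Λ η')) (disagreementExit (S := S) G Λ Δ) := by
  classical
  haveI := hγ.isProbability Λ η
  haveI := hγ.isProbability Λ η'
  set B : Set ((↥Λ → S) × (↥Λ → S)) := {p | Bad₂ G Λ Δ η η' p} with hB
  -- witnesses
  have hwit : ∀ p : (↥Λ → S) × (↥Λ → S), ∃ T : Finset V, (∀ v ∈ T, v ∉ Λ) ∧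
      (p ∈ B → ∀ σ σ' : V → S, σ ∈ fiber Λ η p.1 → σ' ∈ fiber Λ η' p.2 →
        (∀ v ∈ T, σ v = η v) → (∀ v ∈ T, σ' v = η' v) →
          (σ, σ') ∈ disagreementExit (S := S) G Λ Δ) := by
    intro p
    by_cases hp : p ∈ B
    · obtain ⟨x, hx, y, hy, w, hw⟩ := hp
      refine ⟨w.support.toFinset.filter (fun v => v ∉ Λ), fun v hv => (Finset.mem_filter.1 hv).2,
        fun _ σ σ' hσ hσ' hT hT' => ⟨x, hx, y, hy, w, fun v hv => ?_⟩⟩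
      have hd := hw v hv
      by_cases hvΛ : v ∈ Λ
      · show σ v ≠ σ' v
        rw [mem_fiber'.1 hσ v hvΛ, mem_fiber'.1 hσ' v hvΛ]
        exact (dis₂_iff_of_mem' hvΛ).1 hd
      · have hvT : v ∈ w.support.toFinset.filter (fun v => v ∉ Λ) :=
          Finset.mem_filter.2 ⟨List.mem_toFinset.2 hv, hvΛ⟩
        show σ v ≠ σ' v
        rw [hT v hvT, hT' v hvT]
        exact (dis₂_iff_of_not_mem' hvΛ).1 hd
    · exact ⟨∅, fun v hv => absurd hv (Finset.notMem_empty v), fun h => absurd h hp⟩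
  choose T hTΛ hT using hwit
  set F₁ : Set (V → S) := {σ | ∀ p, ∀ v ∈ T p, σ v = η v} with hF₁
  set F₂ : Set (V → S) := {σ | ∀ p, ∀ v ∈ T p, σ v = η' v} with hF₂
  have h1 : ∀ᵐ σ ∂(γ Λ η), σ ∈ F₁ := by
    filter_upwards [hγ.proper Λ η] with σ hσ
    exact fun p v hv => hσ v (hTΛ p v hv)
  have h2 : ∀ᵐ σ ∂(γ Λ η'), σ ∈ F₂ := by
    filter_upwards [hγ.proper Λ η'] with σ hσ
    exact fun p v hv => hσ v (hTΛ p v hv)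
  have hnull : ((γ Λ η).prod (γ Λ η')) (F₁ ×ˢ F₂)ᶜ = 0 :=
    Measure.measure_prod_compl_eq_zero (mem_ae_iff.1 h1) (mem_ae_iff.1 h2)
  -- the rectangles over the bad pairs, a countable disjoint union
  set R : Set ((V → S) × (V → S)) := ⋃ p : ↥B, fiber Λ η p.1.1 ×ˢ fiber Λ η' p.1.2 with hR
  have hRsub : R ∩ (F₁ ×ˢ F₂) ⊆ disagreementExit (S := S) G Λ Δ := by
    rintro ⟨σ, σ'⟩ ⟨hσR, hσF⟩
    rw [hR, Set.mem_iUnion] at hσR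
    obtain ⟨p, hpr⟩ := hσR
    rw [Set.mem_prod] at hpr hσF
    exact hT p.1 p.2 σ σ' hpr.1 hpr.2 (fun v hv => hσF.1 p.1 v hv) (fun v hv => hσF.2 p.1 v hv)
  have hRmeas : ((γ Λ η).prod (γ Λ η')) R =
      ∑' p : (↥Λ → S) × (↥Λ → S), B.indicator (fun p => γ Λ η (fiber Λ η p.1) * γ Λ η' (fiber Λ η' p.2)) p := by
    rw [hR, measure_iUnion, ← tsum_subtype B (fun p => γ Λ η (fiber Λ η p.1) * γ Λ η' (fiber Λ η' p.2))]
    · exact tsum_congr fun p => Measure.prod_prod _ _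
    · intro p q hpq
      rw [Function.onFun, Set.disjoint_prod]
      have hpq' : p.1 ≠ q.1 := fun h => hpq (Subtype.ext h)
      by_cases h1 : p.1.1 = q.1.1
      · right
        exact disjoint_fiber' η' fun h2 => hpq' (Prod.ext h1 h2)
      · left; exact disjoint_fiber' η h1
    · exact fun p => (measurableSet_fiber' η p.1.1).prod (measurableSet_fiber' η' p.1.2)
  rw [← hRmeas]
  calc ((γ Λ η).prod (γ Λ η')) R
      ≤ ((γ Λ η).prod (γ Λ η')) (R ∩ (F₁ ×ˢ F₂)) + ((γ Λ η).prod (γ Λ η')) (R \ (F₁ ×ˢ F₂)) :=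
        measure_le_inter_add_sdiff _ _ _
    _ ≤ ((γ Λ η).prod (γ Λ η')) (disagreementExit (S := S) G Λ Δ) +
          ((γ Λ η).prod (γ Λ η')) (F₁ ×ˢ F₂)ᶜ :=
        add_le_add (measure_mono hRsub) (measure_mono (Set.sdiff_subset_compl _ _))
    _ = ((γ Λ η).prod (γ Λ η')) (disagreementExit (S := S) G Λ Δ) := by rw [hnull, add_zero]

/-- **[vdB93] (3)–(4) / [GHM01] Prop. 7.10 for a COUNTABLE spin space**: for a Markov specification, `Δ ⊆ Λ`
finite, boundary conditions `η, η′` and a `Δ`-local event `A`,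
`|γ_Λ(A|η) − γ_Λ(A|η′)| ≤ (γ_Λ^η ⊗ γ_Λ^{η′})(Δ ↔≠ ∂Λ)` (exchange on the disagreement cluster of `Δ`; the
good parts of the two countable fibre sums agree termwise after reindexing by the exchange).
[cite: Vandenberg1993, Theorem 1 (proof, (3)–(4))] -/
theorem coupling_bound_countable [MeasurableSingletonClass S] [Countable S] [DecidableEq V]
    [G.LocallyFinite] {γ : Specification V S} (hγ : IsSpecification γ) (hM : γ.IsMarkov G)
    (hΔ : Δ ⊆ Λ) {A : Set (V → S)} (hA : MeasurableSet A) (hdA : DependsOn (· ∈ A) (↑Δ : Set V)) :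
    |(γ Λ η).real A - (γ Λ η').real A| ≤
      ((γ Λ η).prod (γ Λ η')).real (disagreementExit (S := S) G Λ Δ) := by
  classical
  haveI := hγ.isProbability Λ η
  haveI := hγ.isProbability Λ η'
  have hdAΛ : DependsOn (· ∈ A) (↑Λ : Set V) := hdA.mono (Finset.coe_subset.2 hΔ)
  set μ₁ := γ Λ η with hμ₁
  set μ₂ := γ Λ η' with hμ₂
  set π := μ₁.prod μ₂ with hπ
  -- weights, the `A`-predicate and the good set
  set ν₁ : (↥Λ → S) → ℝ≥0∞ := fun ζ => μ₁ (fiber Λ η ζ) with hν₁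
  set ν₂ : (↥Λ → S) → ℝ≥0∞ := fun ζ => μ₂ (fiber Λ η' ζ) with hν₂
  set Aset : Set (↥Λ → S) := {ζ | glueWith Λ ζ η ∈ A} with hAset
  set w : (↥Λ → S) × (↥Λ → S) → ℝ≥0∞ := fun p => ν₁ p.1 * ν₂ p.2 with hw
  set A₁ : Set ((↥Λ → S) × (↥Λ → S)) := {p | p.1 ∈ Aset} with hA₁
  set A₂ : Set ((↥Λ → S) × (↥Λ → S)) := {p | p.2 ∈ Aset} with hA₂
  set E : Set ((↥Λ → S) × (↥Λ → S)) := {p | ¬ Bad₂ G Λ Δ η η' p} with hE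
  set Bd : ℝ≥0∞ := ∑' p, Eᶜ.indicator w p with hBd
  -- the two probabilities as pair sums
  have T₁ : μ₁ A = ∑' p, A₁.indicator w p := by
    rw [measure_eq_tsum_fiber (θ := η) (η := η) μ₁ hA hdAΛ]
    have e : ∀ p : (↥Λ → S) × (↥Λ → S), A₁.indicator w p = Aset.indicator ν₁ p.1 * ν₂ p.2 := by
      intro p
      simp only [hA₁, hw, Set.indicator_apply, Set.mem_setOf_eq]
      split_ifs <;> simp
    simp_rw [e]
    rw [ENNReal.tsum_prod']
    refine tsum_congr fun ζ => ?_
    dsimp only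
    rw [ENNReal.tsum_mul_left, tsum_fiber_eq_one η' μ₂, mul_one]
  have T₂ : μ₂ A = ∑' p, A₂.indicator w p := by
    rw [measure_eq_tsum_fiber (θ := η') (η := η) μ₂ hA hdAΛ]
    have e : ∀ p : (↥Λ → S) × (↥Λ → S), A₂.indicator w p = ν₁ p.1 * Aset.indicator ν₂ p.2 := by
      intro p
      simp only [hA₂, hw, Set.indicator_apply, Set.mem_setOf_eq]
      split_ifs <;> simp
    simp_rw [e]
    rw [ENNReal.tsum_prod', ENNReal.tsum_comm]
    refine tsum_congr fun ζ => ?_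
    dsimp only
    rw [ENNReal.tsum_mul_right, tsum_fiber_eq_one η μ₁, one_mul]
  -- the exchange: a weight-preserving bijection of the good set exchanging `A₂` and `A₁`
  have hmaps : Set.MapsTo (exch₂ G Λ Δ η η') E E := fun p hp => by
    simp only [hE, Set.mem_setOf_eq] at hp ⊢; rwa [bad₂_exch₂]
  have hbij : Set.BijOn (exch₂ G Λ Δ η η') E E :=
    ⟨hmaps, fun p _ q _ hpq => by
      calc p = exch₂ G Λ Δ η η' (exch₂ G Λ Δ η η' p) := (exch₂_exch₂ p).symm
        _ = exch₂ G Λ Δ η η' (exch₂ G Λ Δ η η' q) := by rw [hpq]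
        _ = q := exch₂_exch₂ q,
      fun q hq => ⟨exch₂ G Λ Δ η η' q, hmaps hq, exch₂_exch₂ q⟩⟩
  have hwT : ∀ p ∈ E, w (exch₂ G Λ Δ η η' p) = w p := fun p hp => by
    simp only [hw, hν₁, hν₂]
    exact weight_exch₂ hγ hM hp
  have hswap : ∀ p, (exch₂ G Λ Δ η η' p ∈ A₂ ↔ p ∈ A₁) := fun p => by
    simp only [hA₁, hA₂, hAset, Set.mem_setOf_eq]
    have h : (glueWith Λ (exch₂ G Λ Δ η η' p).2 η ∈ A) = (glueWith Λ p.1 η ∈ A) :=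
      hdA fun x hx => by
        have hxΛ : x ∈ Λ := hΔ (Finset.mem_coe.1 hx)
        rw [glueWith_apply_mem Λ _ η hxΛ, glueWith_apply_mem Λ _ η hxΛ]
        exact exch₂_snd_eq_fst_of_mem (Finset.mem_coe.1 hx) hxΛ
    exact Iff.of_eq h
  have hgood : ∑' p, E.indicator (A₂.indicator w) p = ∑' p, E.indicator (A₁.indicator w) p := by
    rw [← tsum_subtype E (A₂.indicator w), ← tsum_subtype E (A₁.indicator w),
      ← Equiv.tsum_eq (hbij.equiv _)]
    refine tsum_congr fun q => ?_
    have hq : (q : (↥Λ → S) × (↥Λ → S)) ∈ E := q.2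
    show A₂.indicator w (exch₂ G Λ Δ η η' q) = A₁.indicator w q
    rw [Set.indicator_apply, Set.indicator_apply]
    by_cases h1 : (q : (↥Λ → S) × (↥Λ → S)) ∈ A₁
    · rw [if_pos ((hswap q).2 h1), if_pos h1, hwT q hq]
    · rw [if_neg (fun h2 => h1 ((hswap q).1 h2)), if_neg h1]
  -- split good/bad
  have split : ∀ F : (↥Λ → S) × (↥Λ → S) → ℝ≥0∞,
      ∑' p, F p = ∑' p, E.indicator F p + ∑' p, Eᶜ.indicator F p := fun F => by
    rw [← ENNReal.tsum_add]
    exact tsum_congr fun p => (congrFun (Set.indicator_self_add_compl E F) p).symm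
  have hle : ∀ (X : Set ((↥Λ → S) × (↥Λ → S))), ∑' p, Eᶜ.indicator (X.indicator w) p ≤ Bd := fun X =>
    ENNReal.tsum_le_tsum fun p => Set.indicator_le_indicator (Set.indicator_le_self _ _ p)
  have h12 : μ₁ A ≤ μ₂ A + Bd := by
    rw [T₁, T₂, split (A₁.indicator w), split (A₂.indicator w), hgood]
    exact add_le_add (le_self_add) (hle A₁)
  have h21 : μ₂ A ≤ μ₁ A + Bd := by
    rw [T₁, T₂, split (A₁.indicator w), split (A₂.indicator w), hgood]
    exact add_le_add (le_self_add) (hle A₂)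
  -- the bad weight is at most the probability of the exit event
  have hBd : Bd ≤ π (disagreementExit (S := S) G Λ Δ) := by
    have e : ∀ p, Eᶜ.indicator w p =
        {p | Bad₂ G Λ Δ η η' p}.indicator (fun p => γ Λ η (fiber Λ η p.1) * γ Λ η' (fiber Λ η' p.2)) p := by
      intro p
      have hc : Eᶜ = {p | Bad₂ G Λ Δ η η' p} := by ext p; simp [hE]
      rw [hc]
    rw [hBd, tsum_congr e]
    exact tsum_bad_le_prod_exit hγ
  -- pass to real numbers
  have hfin : π (disagreementExit (S := S) G Λ Δ) ≠ ∞ := measure_ne_top _ _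
  have hBdfin : Bd ≠ ∞ := ne_top_of_le_ne_top hfin hBd
  have r1 : μ₁.real A ≤ μ₂.real A + π.real (disagreementExit (S := S) G Λ Δ) := by
    simp only [measureReal_def]
    calc (μ₁ A).toReal ≤ (μ₂ A + Bd).toReal := ENNReal.toReal_mono (by finiteness) h12
      _ = (μ₂ A).toReal + Bd.toReal := ENNReal.toReal_add (measure_ne_top _ _) hBdfin
      _ ≤ (μ₂ A).toReal + (π (disagreementExit (S := S) G Λ Δ)).toReal :=
          add_le_add le_rfl (ENNReal.toReal_mono hfin hBd)
  have r2 : μ₂.real A ≤ μ₁.real A + π.real (disagreementExit (S := S) G Λ Δ) := by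
    simp only [measureReal_def]
    calc (μ₂ A).toReal ≤ (μ₁ A + Bd).toReal := ENNReal.toReal_mono (by finiteness) h21
      _ = (μ₁ A).toReal + Bd.toReal := ENNReal.toReal_add (measure_ne_top _ _) hBdfin
      _ ≤ (μ₁ A).toReal + (π (disagreementExit (S := S) G Λ Δ)).toReal :=
          add_le_add le_rfl (ENNReal.toReal_mono hfin hBd)
  rw [abs_sub_le_iff]
  constructor <;> linarith

end Countable


/-! ### Local events determine a finite measure on `S^V` -/

/-- Two finite measures on `S^V` with the same mass that agree on all local (cylinder) events are equal
(the measurable cylinders form a generating π-system). [folklore] -/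
private theorem measure_eq_of_forall_local {μ ν : Measure (V → S)} [IsFiniteMeasure μ]
    (huniv : μ Set.univ = ν Set.univ)
    (h : ∀ (Δ : Finset V) (A : Set (V → S)), MeasurableSet A → DependsOn (· ∈ A) (↑Δ : Set V) →
      μ A = ν A) :
    μ = ν := by
  refine ext_of_generate_finite (measurableCylinders fun _ : V => S)
    generateFrom_measurableCylinders.symm isPiSystem_measurableCylinders (fun s hs => ?_) huniv
  obtain ⟨Δ, B, hB, rfl⟩ := (mem_measurableCylinders s).1 hs
  refine h Δ _ (MeasurableSet.cylinder Δ hB) fun σ τ hστ => ?_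
  have hres : Δ.restrict σ = Δ.restrict τ := funext fun i => hστ i.1 (Finset.mem_coe.2 i.2)
  simp only [mem_cylinder, hres]

/-! ### The product of two Gibbs measures is consistent with the product kernels -/

/-- **DLR for the duplicated system**: for Gibbs measures `μ, ν` of `γ` and every finite `Λ`,
`∫∫ (γ_Λ^ω ⊗ γ_Λ^η)(E) μ(dω) ν(dη) = (μ ⊗ ν)(E)` for every measurable `E ⊆ S^V × S^V` (rectangles by
the DLR equations and Tonelli, then the π-λ theorem). [folklore] -/
private theorem lintegral_prod_prod_eq {γ : Specification V S} (hγ : IsSpecification γ) {μ ν : Measure (V → S)}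
    (hμ : IsGibbsMeasure γ μ) (hν : IsGibbsMeasure γ ν) (Λ : Finset V)
    {E : Set ((V → S) × (V → S))} (hE : MeasurableSet E) :
    ∫⁻ p, ((γ Λ p.1).prod (γ Λ p.2)) E ∂(μ.prod ν) = (μ.prod ν) E := by
  haveI := hμ.isProbabilityMeasure
  haveI := hν.isProbabilityMeasure
  haveI : ∀ η, IsProbabilityMeasure (γ Λ η) := fun η => hγ.isProbability Λ η
  -- `γ_Λ` as a kernel for the full product σ-algebra
  let κ₀ : Kernel (V → S) (V → S) :=
    ⟨γ Λ, (hγ.toKernel Λ).measurable.mono cylinderEvents_le_pi le_rfl⟩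
  haveI : IsMarkovKernel κ₀ := ⟨fun η => hγ.isProbability Λ η⟩
  let κ : Kernel ((V → S) × (V → S)) ((V → S) × (V → S)) :=
    (κ₀.comap Prod.fst measurable_fst) ×ₖ (κ₀.comap Prod.snd measurable_snd)
  have hκ : ∀ p, κ p = (γ Λ p.1).prod (γ Λ p.2) := fun p => by
    show ((κ₀.comap Prod.fst measurable_fst) ×ₖ (κ₀.comap Prod.snd measurable_snd)) p = _
    rw [Kernel.prod_apply, Kernel.comap_apply, Kernel.comap_apply]
    rfl
  have hms : ∀ s : Set (V → S), MeasurableSet s → Measurable fun ω : V → S => γ Λ ω s :=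
    fun s hs => (hγ.measurable Λ s hs).mono cylinderEvents_le_pi le_rfl
  have hbind : μ.prod ν = (μ.prod ν).bind κ := by
    refine Measure.prod_eq fun s t hs ht => ?_
    rw [Measure.bind_apply (hs.prod ht) κ.measurable.aemeasurable]
    simp_rw [hκ, Measure.prod_prod]
    rw [lintegral_prod_mul (hms s hs).aemeasurable (hms t ht).aemeasurable, hμ.2 Λ s hs, hν.2 Λ t ht]
  calc ∫⁻ p, ((γ Λ p.1).prod (γ Λ p.2)) E ∂(μ.prod ν) = ∫⁻ p, κ p E ∂(μ.prod ν) := by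
        simp_rw [hκ]
    _ = ((μ.prod ν).bind κ) E := (Measure.bind_apply hE κ.measurable.aemeasurable).symm
    _ = (μ.prod ν) E := by rw [← hbind]

/-! ### Measurability of `{Δ ↔≠ ∂Λ}` on a countable graph -/

section Chains

variable (G : SimpleGraph V)

/-- A chain of `n + 1` consecutively adjacent vertices along which the pair `ξ` disagrees (the vertex sequence of a
path of disagreement). [cite: Vandenberg1993, Theorem 1 (proof: «path of disagreement»)] -/
def IsDisChain (ξ : (V → S) × (V → S)) (n : ℕ) (f : Fin (n + 1) → V) : Prop :=
  (∀ i : Fin n, G.Adj (f i.castSucc) (f i.succ)) ∧ ∀ i, ξ.1 (f i) ≠ ξ.2 (f i)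

variable {G}

omit [MeasurableSpace S] in
/-- A walk of disagreement gives a chain of disagreement (its vertex sequence). [folklore] -/
private theorem exists_chain_of_walk {ξ : (V → S) × (V → S)} {x y : V} (w : G.Walk x y)
    (hw : ∀ v ∈ w.support, ξ.1 v ≠ ξ.2 v) :
    ∃ f : Fin (w.length + 1) → V, f 0 = x ∧ f (Fin.last _) = y ∧ IsDisChain G ξ w.length f :=
  ⟨fun i => w.getVert i, by simp, by simp,
    fun i => by simpa using w.adj_getVert_succ i.2, fun i => hw _ (w.getVert_mem_support i)⟩

omit [MeasurableSpace S] in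
/-- A chain of disagreement gives a walk of disagreement. [folklore] -/
private theorem exists_walk_of_chain {ξ : (V → S) × (V → S)} :
    ∀ (n : ℕ) (f : Fin (n + 1) → V), IsDisChain G ξ n f →
      ∃ w : G.Walk (f 0) (f (Fin.last n)), ∀ v ∈ w.support, ξ.1 v ≠ ξ.2 v := by
  intro n
  induction n with
  | zero =>
    intro f hf
    refine ⟨(SimpleGraph.Walk.nil : G.Walk (f 0) (f 0)).copy rfl (congrArg f (Fin.ext rfl)), fun v hv => ?_⟩
    rw [SimpleGraph.Walk.support_copy, SimpleGraph.Walk.support_nil, List.mem_singleton] at hv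
    subst hv
    exact hf.2 0
  | succ n ih =>
    intro f hf
    have hg : IsDisChain G ξ n (fun i => f i.succ) :=
      ⟨fun i => by
        have h := hf.1 i.succ
        rwa [← Fin.succ_castSucc] at h, fun i => hf.2 i.succ⟩
    obtain ⟨w, hw⟩ := ih _ hg
    have h01 : G.Adj (f 0) (f (0 : Fin (n + 1)).succ) := by
      have h := hf.1 0
      rwa [Fin.castSucc_zero] at h
    refine ⟨(SimpleGraph.Walk.cons h01 w).copy rfl (by rw [Fin.succ_last]), fun v hv => ?_⟩
    rw [SimpleGraph.Walk.support_copy, SimpleGraph.Walk.support_cons, List.mem_cons] at hv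
    rcases hv with rfl | hv
    · exact hf.2 0
    · exact hw v hv

omit [MeasurableSpace S] in
/-- `{Δ ↔≠ ∂Λ}` in terms of chains. [folklore] -/
private theorem mem_disagreementExit_iff_chain {Λ Δ : Finset V} {ξ : (V → S) × (V → S)} :
    ξ ∈ disagreementExit (S := S) G Λ Δ ↔
      ∃ x ∈ Δ, ∃ y, y ∉ Λ ∧ ∃ (n : ℕ) (f : Fin (n + 1) → V),
        f 0 = x ∧ f (Fin.last n) = y ∧ IsDisChain G ξ n f := by
  constructor
  · rintro ⟨x, hx, y, hy, w, hw⟩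
    obtain ⟨f, h0, hl, hf⟩ := exists_chain_of_walk w hw
    exact ⟨x, hx, y, hy, _, f, h0, hl, hf⟩
  · rintro ⟨x, hx, y, hy, n, f, h0, hl, hf⟩
    obtain ⟨w, hw⟩ := exists_walk_of_chain n f hf
    subst h0; subst hl
    exact ⟨_, hx, _, hy, w, hw⟩

/-- On a countable graph with a countable spin space, `{Δ ↔≠ ∂Λ}` is a measurable event of the pair.
[cite: GeorgiiHaggstromMaes2001, §7.1] -/
theorem measurableSet_disagreementExit [Countable V] [Countable S] [MeasurableSingletonClass S]
    (Λ Δ : Finset V) : MeasurableSet (disagreementExit (S := S) G Λ Δ) := by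
  have hdis : ∀ v : V, MeasurableSet {ξ : (V → S) × (V → S) | ξ.1 v ≠ ξ.2 v} := fun v =>
    (measurableSet_eq_fun ((measurable_pi_apply v).comp measurable_fst)
      ((measurable_pi_apply v).comp measurable_snd)).compl
  have hrepr : disagreementExit (S := S) G Λ Δ =
      ⋃ x ∈ (↑Δ : Set V), ⋃ y ∈ (↑Λ : Set V)ᶜ, ⋃ n : ℕ, ⋃ f : Fin (n + 1) → V,
        {_ξ | f 0 = x ∧ f (Fin.last n) = y ∧ ∀ i : Fin n, G.Adj (f i.castSucc) (f i.succ)} ∩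
          ⋂ i : Fin (n + 1), {ξ : (V → S) × (V → S) | ξ.1 (f i) ≠ ξ.2 (f i)} := by
    ext ξ
    rw [mem_disagreementExit_iff_chain]
    simp only [Set.mem_iUnion, Set.mem_inter_iff, Set.mem_setOf_eq, Set.mem_iInter, Set.mem_compl_iff,
      Finset.mem_coe, exists_prop, IsDisChain]
    constructor
    · rintro ⟨x, hx, y, hy, n, f, h0, hl, hadj, hd⟩
      exact ⟨x, hx, y, hy, n, f, ⟨h0, hl, hadj⟩, hd⟩
    · rintro ⟨x, hx, y, hy, n, f, ⟨h0, hl, hadj⟩, hd⟩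
      exact ⟨x, hx, y, hy, n, f, h0, hl, hadj, hd⟩
  rw [hrepr]
  refine MeasurableSet.biUnion Δ.countable_toSet fun x _ =>
    MeasurableSet.biUnion (Set.to_countable _) fun y _ =>
      MeasurableSet.iUnion fun n => MeasurableSet.iUnion fun f =>
        (MeasurableSet.const _).inter (MeasurableSet.iInter fun i => hdis (f i))

end Chains

/-! ### Balls around `Δ` and Kőnig's lemma: exits from every ball give an infinite path of disagreement -/

section Konig

variable (G : SimpleGraph V) [DecidableEq V] [G.LocallyFinite]

/-- The graph ball of radius `n` around the finite set `Δ` (as a finite set of vertices): the exhausting volumes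
`Λ_n` of the proof. [cite: Vandenberg1993, Theorem 1 (proof)] -/
def ball (Δ : Finset V) : ℕ → Finset V
  | 0 => Δ
  | n + 1 => ball Δ n ∪ (ball Δ n).biUnion fun v => G.neighborFinset v

variable {G}

omit [MeasurableSpace S] in
/-- Balls increase. [folklore] -/
private theorem ball_subset_succ (Δ : Finset V) (n : ℕ) : ball G Δ n ⊆ ball G Δ (n + 1) :=
  fun _ hv => Finset.mem_union_left _ hv

omit [MeasurableSpace S] in
/-- Balls increase. [folklore] -/
private theorem ball_mono (Δ : Finset V) : Monotone (ball G Δ) :=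
  monotone_nat_of_le_succ fun n => ball_subset_succ Δ n

omit [MeasurableSpace S] in
/-- `Δ` lies in all its balls. [folklore] -/
private theorem subset_ball (Δ : Finset V) (n : ℕ) : Δ ⊆ ball G Δ n :=
  ball_mono Δ (Nat.zero_le n)

omit [MeasurableSpace S] in
/-- A neighbour of the `n`-ball lies in the `(n+1)`-ball. [folklore] -/
private theorem mem_ball_succ_of_adj {Δ : Finset V} {n : ℕ} {v w : V} (hv : v ∈ ball G Δ n) (hadj : G.Adj v w) :
    w ∈ ball G Δ (n + 1) :=
  Finset.mem_union_right _ (Finset.mem_biUnion.2 ⟨v, hv, (G.mem_neighborFinset v w).2 hadj⟩)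

omit [MeasurableSpace S] in
/-- The `i`-th vertex of a walk from `Δ` lies in the `i`-ball. [folklore] -/
private theorem getVert_mem_ball {Δ : Finset V} {x y : V} (hx : x ∈ Δ) (w : G.Walk x y) (i : ℕ) :
    w.getVert i ∈ ball G Δ i := by
  induction i with
  | zero => rw [w.getVert_zero]; exact hx
  | succ i ih =>
    by_cases hi : i < w.length
    · exact mem_ball_succ_of_adj ih (w.adj_getVert_succ hi)
    · have h1 : w.getVert (i + 1) = w.getVert i := by
        rw [w.getVert_of_length_le (by omega), w.getVert_of_length_le (by omega)]
      rw [h1]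
      exact ball_subset_succ Δ i ih

omit [MeasurableSpace S] in
/-- A walk from `Δ` leaving the `n`-ball has more than `n` edges. [folklore] -/
private theorem lt_length_of_not_mem_ball {Δ : Finset V} {n : ℕ} {x y : V} (hx : x ∈ Δ) (w : G.Walk x y)
    (hy : y ∉ ball G Δ n) : n < w.length := by
  by_contra h
  have hmem := getVert_mem_ball hx w n
  rw [w.getVert_of_length_le (not_lt.1 h)] at hmem
  exact hy hmem

/-- Self-avoiding chains of disagreement with `n + 1` vertices starting in `Δ` (the levels of the tree to
which Kőnig's lemma is applied). [cite: Vandenberg1993, Theorem 1 (proof: «an infinite path of disagreement»)] -/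
def PathSp (G : SimpleGraph V) (Δ : Finset V) (ξ : (V → S) × (V → S)) (n : ℕ) : Type u :=
  {f : Fin (n + 1) → V // f 0 ∈ Δ ∧ Function.Injective f ∧
    (∀ i : Fin n, G.Adj (f i.castSucc) (f i.succ)) ∧ ∀ i, ξ.1 (f i) ≠ ξ.2 (f i)}

variable {Δ : Finset V} {ξ : (V → S) × (V → S)}

omit [MeasurableSpace S] [DecidableEq V] [G.LocallyFinite] in
/-- Truncation commutes with `castSucc`. [folklore] -/
private theorem castLE_castSucc {i j : ℕ} (hij : i + 1 ≤ j + 1) (k : Fin i) :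
    Fin.castLE hij k.castSucc = (Fin.castLE (by omega) k : Fin j).castSucc :=
  Fin.ext (by simp)

omit [MeasurableSpace S] [DecidableEq V] [G.LocallyFinite] in
/-- Truncation commutes with successor. [folklore] -/
private theorem castLE_succ {i j : ℕ} (hij : i + 1 ≤ j + 1) (k : Fin i) :
    Fin.castLE hij k.succ = (Fin.castLE (by omega) k : Fin j).succ :=
  Fin.ext (by simp)

/-- Truncation of a self-avoiding chain of disagreement (the projections of Kőnig's lemma). [cite: Vandenberg1993, Theorem 1 (proof)] -/
def proj {i j : ℕ} (hij : i ≤ j) (f : PathSp (S := S) G Δ ξ j) : PathSp (S := S) G Δ ξ i :=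
  ⟨fun k => f.1 (Fin.castLE (by omega) k),
    by
      have h0 : Fin.castLE (show i + 1 ≤ j + 1 by omega) (0 : Fin (i + 1)) = 0 := Fin.ext (by simp)
      simp only [h0]; exact f.2.1,
    fun k k' h => Fin.castLE_injective _ (f.2.2.1 h),
    fun k => by
      dsimp only
      rw [castLE_castSucc, castLE_succ]
      exact f.2.2.2.1 _,
    fun k => f.2.2.2.2 _⟩

omit [MeasurableSpace S] [DecidableEq V] [G.LocallyFinite] in
/-- Values of the truncation. [folklore] -/
@[simp] private theorem proj_apply {i j : ℕ} (hij : i ≤ j) (f : PathSp (S := S) G Δ ξ j) (k : Fin (i + 1)) :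
    (proj hij f).1 k = f.1 (Fin.castLE (by omega) k) := rfl

omit [MeasurableSpace S] in
/-- **Kőnig step**: if the pair `ξ` has a path of disagreement from `Δ` out of every ball around `Δ`, it
has an infinite self-avoiding path of disagreement. [cite: Vandenberg1993, Theorem 1 (proof: «an infinite
path of disagreement»)] -/
theorem hasInfiniteDisagreementPath_of_forall_exit
    (h : ∀ n, ξ ∈ disagreementExit (S := S) G (ball G Δ n) Δ) :
    HasInfiniteDisagreementPath G ξ.1 ξ.2 := by
  classical
  -- every level is nonempty
  have hne : ∀ n, Nonempty (PathSp (S := S) G Δ ξ n) := by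
    intro n
    obtain ⟨x, hx, y, hy, w, hw⟩ := h n
    set p := w.bypass with hp
    have hpath : p.IsPath := w.bypass_isPath
    have hlen : n < p.length := lt_length_of_not_mem_ball hx p hy
    have hsup : ∀ v ∈ p.support, ξ.1 v ≠ ξ.2 v :=
      fun v hv => hw v (w.support_bypass_subset_support hv)
    refine ⟨⟨fun k => p.getVert k, ?_, ?_, ?_, ?_⟩⟩
    · simpa using hx
    · intro k k' hkk'
      exact Fin.ext (hpath.getVert_injOn (by simp only [Set.mem_setOf_eq]; omega)
        (by simp only [Set.mem_setOf_eq]; omega) hkk')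
    · intro k
      simpa using p.adj_getVert_succ (i := k) (by omega)
    · intro k
      exact hsup _ (p.getVert_mem_support k)
  -- the zeroth level is finite (a chain with one vertex is its starting point in `Δ`)
  haveI : Finite (PathSp (S := S) G Δ ξ 0) := by
    refine Finite.of_injective (fun f : PathSp (S := S) G Δ ξ 0 => (⟨f.1 0, f.2.1⟩ : ↥Δ)) ?_
    intro f g hfg
    apply Subtype.ext
    funext k
    have hk : k = 0 := Fin.fin_one_eq_zero k
    subst hk
    exact congrArg Subtype.val hfg
  haveI : ∀ n, Nonempty (PathSp (S := S) G Δ ξ n) := hne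
  -- finitely many one-step extensions (local finiteness)
  have hfin : ∀ i (a : PathSp (S := S) G Δ ξ i),
      {b : PathSp (S := S) G Δ ξ (i + 1) | proj (Nat.le_add_right i 1) b = a}.Finite := by
    intro i a
    refine Set.Finite.of_finite_image (f := fun b : PathSp (S := S) G Δ ξ (i + 1) => b.1 (Fin.last (i + 1)))
      ?_ ?_
    · refine (G.neighborFinset (a.1 (Fin.last i))).finite_toSet.subset ?_
      rintro _ ⟨b, hb, rfl⟩
      rw [Finset.mem_coe, SimpleGraph.mem_neighborFinset]
      have hadj := b.2.2.2.1 (Fin.last i)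
      rw [Fin.succ_last] at hadj
      have hlast : b.1 (Fin.last i).castSucc = a.1 (Fin.last i) := by
        rw [← hb, proj_apply]
        exact congrArg b.1 (Fin.ext (by simp))
      rwa [hlast] at hadj
    · intro b hb b' hb' heq
      apply Subtype.ext
      funext k
      by_cases hk : (k : ℕ) ≤ i
      · have e : k = Fin.castLE (by omega) (⟨k, by omega⟩ : Fin (i + 1)) := Fin.ext (by simp)
        have h1 : (proj (Nat.le_add_right i 1) b).1 ⟨k, by omega⟩ =
            (proj (Nat.le_add_right i 1) b').1 ⟨k, by omega⟩ := by
          rw [Set.mem_setOf_eq] at hb hb'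
          rw [hb, hb']
        rw [proj_apply, proj_apply] at h1
        rw [e]; exact h1
      · have e : k = Fin.last (i + 1) := Fin.ext (by simp only [Fin.val_last]; omega)
        rw [e]; exact heq
  obtain ⟨g, hg⟩ := exists_seq_forall_proj_of_forall_finite (α := PathSp (S := S) G Δ ξ)
    (fun hij f => proj hij f)
    (fun i a => Subtype.ext (funext fun k => congrArg a.1 (Fin.ext (by simp))))
    (fun i j k hij hjk a => Subtype.ext (funext fun k => congrArg a.1 (Fin.ext (by simp))))
    hfin
  -- the infinite path: the last vertex of each level
  refine ⟨fun m => (g m).1 (Fin.last m), fun m => ?_, ?_, fun m => (g m).2.2.2.2 _⟩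
  · -- consecutive last vertices are adjacent
    have hadj := (g (m + 1)).2.2.2.1 (Fin.last m)
    rw [Fin.succ_last] at hadj
    have hlast : (g (m + 1)).1 (Fin.last m).castSucc = (g m).1 (Fin.last m) := by
      rw [← hg (Nat.le_add_right m 1), proj_apply]
      exact congrArg (g (m + 1)).1 (Fin.ext (by simp))
    rwa [hlast] at hadj
  · -- the path is injective, hence has infinite range
    refine Set.infinite_range_of_injective fun m m' hmm' => ?_
    have key : ∀ {a b : ℕ} (hab : a ≤ b), (g a).1 (Fin.last a) = (g b).1 ⟨a, by omega⟩ := by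
      intro a b hab
      rw [← hg hab, proj_apply]
      exact congrArg (g b).1 (Fin.ext (by simp))
    rcases le_total m m' with hle | hle
    · have h1 := key hle
      have h2 : (g m').1 (Fin.last m') = (g m').1 ⟨m', by omega⟩ := congrArg (g m').1 (Fin.ext (by simp))
      rw [h1, h2] at hmm'
      exact congrArg Fin.val ((g m').2.2.1 hmm')
    · have h1 := key hle
      have h2 : (g m).1 (Fin.last m) = (g m).1 ⟨m, by omega⟩ := congrArg (g m).1 (Fin.ext (by simp))
      rw [h1, h2] at hmm'
      exact congrArg Fin.val ((g m).2.2.1 hmm')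

end Konig


/-! ### Assembly: [vdB93] Theorem 1 -/

section Assembly

variable [MeasurableSingletonClass S] [Countable S] [Countable V] [DecidableEq V]
  {G : SimpleGraph V} [G.LocallyFinite] {γ : Specification V S}

omit [MeasurableSpace S] [MeasurableSingletonClass S] [Countable S] [Countable V] [DecidableEq V]
  [G.LocallyFinite] in
/-- `{Δ ↔≠ ∂Λ}` shrinks as `Λ` grows. [cite: GeorgiiHaggstromMaes2001, §7.1] -/
theorem disagreementExit_anti {Λ Λ' Δ : Finset V} (h : Λ ⊆ Λ') :
    disagreementExit (S := S) G Λ' Δ ⊆ disagreementExit (S := S) G Λ Δ := by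
  rintro ξ ⟨x, hx, y, hy, w, hw⟩
  exact ⟨x, hx, y, fun hyΛ => hy (h hyΛ), w, hw⟩

omit [MeasurableSingletonClass S] [Countable S] [Countable V] [DecidableEq V] [G.LocallyFinite] in
/-- `(ω, η) ↦ (γ_Λ^ω ⊗ γ_Λ^η)(E)` is measurable (it is the product kernel). [folklore] -/
private theorem measurable_prod_prod_apply (hγ : IsSpecification γ) (Λ : Finset V)
    {E : Set ((V → S) × (V → S))} (hE : MeasurableSet E) :
    Measurable fun p : (V → S) × (V → S) => ((γ Λ p.1).prod (γ Λ p.2)) E := by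
  haveI : ∀ η, IsProbabilityMeasure (γ Λ η) := fun η => hγ.isProbability Λ η
  let κ₀ : Kernel (V → S) (V → S) :=
    ⟨γ Λ, (hγ.toKernel Λ).measurable.mono cylinderEvents_le_pi le_rfl⟩
  haveI : IsMarkovKernel κ₀ := ⟨fun η => hγ.isProbability Λ η⟩
  let κ : Kernel ((V → S) × (V → S)) ((V → S) × (V → S)) :=
    (κ₀.comap Prod.fst measurable_fst) ×ₖ (κ₀.comap Prod.snd measurable_snd)
  have hκ : ∀ p, κ p = (γ Λ p.1).prod (γ Λ p.2) := fun p => by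
    show ((κ₀.comap Prod.fst measurable_fst) ×ₖ (κ₀.comap Prod.snd measurable_snd)) p = _
    rw [Kernel.prod_apply, Kernel.comap_apply, Kernel.comap_apply]
    rfl
  have h := κ.measurable_coe hE
  simp_rw [hκ] at h
  exact h

/-- **Step 2** ([vdB93] p.163, (4) integrated against `μ ⊗ μ′`): for Gibbs measures `μ, μ′` of a Markov
specification with countable spins, `Δ ⊆ Λ` finite and a `Δ`-local event `A`,
`|μ(A) − μ′(A)| ≤ (μ ⊗ μ′)(Δ ↔≠ ∂Λ)`. [cite: Vandenberg1993, Theorem 1 (proof, (4))] -/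
theorem abs_sub_le_prod_exit (hγ : IsSpecification γ) (hM : γ.IsMarkov G) {μ μ' : Measure (V → S)}
    (hμ : IsGibbsMeasure γ μ) (hμ' : IsGibbsMeasure γ μ') {Λ Δ : Finset V} (hΔ : Δ ⊆ Λ)
    {A : Set (V → S)} (hA : MeasurableSet A) (hdA : DependsOn (· ∈ A) (↑Δ : Set V)) :
    |μ.real A - μ'.real A| ≤ (μ.prod μ').real (disagreementExit (S := S) G Λ Δ) := by
  haveI := hμ.isProbabilityMeasure
  haveI := hμ'.isProbabilityMeasure
  haveI : ∀ η, IsProbabilityMeasure (γ Λ η) := fun η => hγ.isProbability Λ η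
  set π := μ.prod μ' with hπ
  have hExit : MeasurableSet (disagreementExit (S := S) G Λ Δ) := measurableSet_disagreementExit Λ Δ
  -- the kernel entries as bounded measurable functions
  have hm : Measurable fun ω : V → S => γ Λ ω A := (hγ.measurable Λ A hA).mono cylinderEvents_le_pi le_rfl
  set g : (V → S) → ℝ := fun ω => (γ Λ ω).real A with hg
  have hgm : Measurable g := hm.ennreal_toReal
  have hg1 : ∀ ω, |g ω| ≤ 1 := fun ω => by
    rw [hg]; dsimp only
    rw [abs_of_nonneg measureReal_nonneg]
    exact measureReal_le_one
  -- DLR in real form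
  have dlr : ∀ {ν : Measure (V → S)}, IsGibbsMeasure γ ν → ν.real A = ∫ ω, g ω ∂ν := by
    intro ν hν
    haveI := hν.isProbabilityMeasure
    rw [hg, measureReal_def, ← hν.2 Λ A hA]
    exact (integral_toReal hm.aemeasurable (ae_of_all _ fun ω => measure_lt_top (γ Λ ω) A)).symm
  -- as a double integral against `π`
  have I₁ : μ.real A = ∫ p, g p.1 ∂π := by
    rw [dlr hμ, hπ, integral_fun_fst, probReal_univ, one_smul]
  have I₂ : μ'.real A = ∫ p, g p.2 ∂π := by
    rw [dlr hμ', hπ, integral_fun_snd, probReal_univ, one_smul]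
  have bnd : ∀ {f : (V → S) × (V → S) → ℝ}, Measurable f → (∀ p, |f p| ≤ 1) → Integrable f π :=
    fun hf h => (integrable_const (1 : ℝ)).mono' hf.aestronglyMeasurable
      (ae_of_all _ fun p => (Real.norm_eq_abs _).le.trans (h p))
  have hint1 : Integrable (fun p : (V → S) × (V → S) => g p.1) π :=
    bnd (hgm.comp measurable_fst) (fun p => hg1 p.1)
  have hint2 : Integrable (fun p : (V → S) × (V → S) => g p.2) π :=
    bnd (hgm.comp measurable_snd) (fun p => hg1 p.2)
  -- the integrand of the right-hand side
  set e : (V → S) × (V → S) → ℝ := fun p => ((γ Λ p.1).prod (γ Λ p.2)).real (disagreementExit (S := S) G Λ Δ)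
    with he
  have hem : Measurable fun p : (V → S) × (V → S) => ((γ Λ p.1).prod (γ Λ p.2)) (disagreementExit (S := S) G Λ Δ) :=
    measurable_prod_prod_apply hγ Λ hExit
  have heint : Integrable e π :=
    bnd hem.ennreal_toReal fun p => by
      rw [he]; dsimp only
      rw [abs_of_nonneg measureReal_nonneg]
      exact measureReal_le_one
  have hIe : ∫ p, e p ∂π = π.real (disagreementExit (S := S) G Λ Δ) := by
    rw [he, measureReal_def, ← lintegral_prod_prod_eq hγ hμ hμ' Λ hExit]
    exact integral_toReal hem.aemeasurable (ae_of_all _ fun p => measure_lt_top _ _)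
  -- pointwise bound (step 1) and integration
  have hpt : ∀ p : (V → S) × (V → S), |g p.1 - g p.2| ≤ e p := fun p =>
    coupling_bound_countable hγ hM hΔ hA hdA
  rw [I₁, I₂, ← integral_sub hint1 hint2, ← hIe]
  calc |∫ p, (g p.1 - g p.2) ∂π| ≤ ∫ p, |g p.1 - g p.2| ∂π := abs_integral_le_integral_abs
    _ ≤ ∫ p, e p ∂π := integral_mono (hint1.sub hint2).abs heint hpt

/-- **Step 3–4**: local events have the same probability under `μ` and `μ′`.
[cite: Vandenberg1993, Theorem 1 (proof)] -/
theorem measure_eq_of_noInfinitePath (hγ : IsSpecification γ) (hM : γ.IsMarkov G) {μ μ' : Measure (V → S)}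
    (hμ : IsGibbsMeasure γ μ) (hμ' : IsGibbsMeasure γ μ')
    (h0 : (μ.prod μ') {ξ | HasInfiniteDisagreementPath G ξ.1 ξ.2} = 0)
    (Δ : Finset V) {A : Set (V → S)} (hA : MeasurableSet A) (hdA : DependsOn (· ∈ A) (↑Δ : Set V)) :
    μ A = μ' A := by
  haveI := hμ.isProbabilityMeasure
  haveI := hμ'.isProbabilityMeasure
  set π := μ.prod μ' with hπ
  set Ex : ℕ → Set ((V → S) × (V → S)) := fun n => disagreementExit (S := S) G (ball G Δ n) Δ with hEx
  -- the bound at every radius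
  have hstep : ∀ n, |μ.real A - μ'.real A| ≤ π.real (Ex n) := fun n =>
    abs_sub_le_prod_exit hγ hM hμ hμ' (subset_ball Δ n) hA hdA
  -- the exit events decrease to a null event
  have hanti : Antitone Ex := fun n m hnm => disagreementExit_anti (ball_mono Δ hnm)
  have hInter : π (⋂ n, Ex n) = 0 := by
    refine nonpos_iff_eq_zero.1 ((measure_mono ?_).trans h0.le)
    intro ξ hξ
    exact hasInfiniteDisagreementPath_of_forall_exit fun n => Set.mem_iInter.1 hξ n
  have hlim : Filter.Tendsto (fun n => π.real (Ex n)) Filter.atTop (nhds 0) := by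
    have h1 : Filter.Tendsto (π ∘ Ex) Filter.atTop (nhds (π (⋂ n, Ex n))) :=
      tendsto_measure_iInter_atTop (fun n => (measurableSet_disagreementExit _ _).nullMeasurableSet)
        hanti ⟨0, measure_ne_top _ _⟩
    rw [hInter] at h1
    have h2 := (ENNReal.tendsto_toReal ENNReal.zero_ne_top).comp h1
    rw [ENNReal.toReal_zero] at h2
    exact h2
  have hle : |μ.real A - μ'.real A| ≤ 0 := ge_of_tendsto' hlim hstep
  have heq : μ.real A = μ'.real A :=
    sub_eq_zero.1 (abs_eq_zero.1 (le_antisymm hle (abs_nonneg _)))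
  exact (ENNReal.toReal_eq_toReal_iff' (measure_ne_top _ _) (measure_ne_top _ _)).1 heq

end Assembly

end DisagreementUniqueness

/-- **[vdB93] Theorem 1 — DISCHARGED** for the fact `Vandenberg1993_uniqueness`: for a Markov specification
with countable spin space (measurable singletons) on a countable locally finite graph, two Gibbs measures
`μ, μ′` whose independent coupling `μ ⊗ μ′` a.s. has no infinite path of disagreement are equal.  Proof:
`DisagreementUniqueness.measure_eq_of_noInfinitePath` (two-boundary-condition bound on countable fibres,
DLR for the duplicated system, Kőnig's lemma along balls) and `measure_eq_of_forall_local`.  (The binders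
are exactly the parameters of the fact; connectedness of `G` is not needed.) [cite: Vandenberg1993, Theorem 1] -/
theorem Vandenberg1993_uniqueness_holds {V : Type*} {S : Type*} [MeasurableSpace S]
    [MeasurableSingletonClass S] [Countable S] [Countable V] [DecidableEq V]
    {G : SimpleGraph V} [G.LocallyFinite] {γ : Specification V S} :
    Vandenberg1993_uniqueness G γ := by
  intro hγ hM _ μ μ' hμ hμ' h0
  rw [mem_gibbsMeasures_iff] at hμ hμ'
  haveI := hμ.isProbabilityMeasure
  haveI := hμ'.isProbabilityMeasure
  exact DisagreementUniqueness.measure_eq_of_forall_local (by rw [measure_univ, measure_univ])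
    fun Δ A hA hdA => DisagreementUniqueness.measure_eq_of_noInfinitePath hγ hM hμ hμ' h0 Δ hA hdA

end Literature.Probability.LatticeModels

end
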